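import Summits.CriticalPhenomena.PercolationContinuityZ3.Theorems.PercNearOneGluingNoHeavyQuantDeepLowsGiants
import Summits.CriticalPhenomena.PercolationContinuityZ3.Theorems.PercNearOneGluingNoHeavyQuantGatedConvSplit
import HarnessLib

/-!
# QUANT lane R8, T-DEC: CONVOLUTION CLOSURE AT THE DOMINANT LAYERS — ONE HEAVY FACTOR SUFFICES.
# If `μ₂` has a HEAVY DEC datum at layer `j` and `μ₁` is merely DEC at every layer (any data, light pairs allowed), then the
# convolution satisfies the FAR row `y ≤ (μ₁ ∗ μ₂){j+1, …}` at every DOMINANT layer `2j < T₁ + T₂`; the tool is a two-layer giant bound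
# ("deep lows ride on the giants") for a single DEC law

builds on p205010 (kernel theorem, internal audit signed; external expert review pending)

Support file (`--supports stmt-CriticalPhenomena-4575`), QUANT lane seat prim-quant-arm-2 (gen 34), rung R8 of
`run/shared/lean/prim/quant/LADDER.md`.  Theorems only (no definitions), standard axioms, no sorries; part 2 of 2 (part 1: `…QuantDeepLowsGiants`, the two-layer giant bound).  Vocabulary: `LawDec.DECAt` /
`ValidAt` (`…QuantLawDEC`), `LawDec.HDECAtT` / `HValidAt` (typer g22, `…QuantSliceHeavy`), `LawDec.lconv` (census-2 g53, `…QuantSDEC`),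
the flow form `flowAtT_of_decAtT` (`…QuantLawDecFlows`), `decAt_of_tail_ge` / `tail_ge_of_decAt` (`…QuantLawDECFarSplit`).

WHAT.  At a DOMINANT layer `j` of the convolution (`2j < T₁ + T₂`, `Tᵢ` the means) DEC(j) IS the far row `y ≤ P(X₁ + X₂ ≥ j+1)`
(`decAt_iff_tail_ge_of_dominant`), a single linear inequality — so no cross-piece ROUTING is needed there, only cross-piece ADDITION.  Typer
g22's `lconv_decAtT_of_hdecAtT` (`…QuantConvHeavy`) certifies the convolution at layer `j` when `μ₂` has a heavy datum at `j` AND `μ₁` has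
heavy data at EVERY layer `≤ j`.  Here the hypothesis on `μ₁` is dropped to plain DEC at every layer (light credit pairs allowed — the
residue class of leg (II)): **`lconv_tail_ge_of_hdecAtT`** — `μ₁` a top-affordable probability law DEC(j′) at every `j′ < M₁`, `μ₂` with a
heavy datum `HDECAtT y T₂ j M₂ μ₂` (any real `T₂`), `2j < T₁ + T₂` ⟹ `y ≤ Σ_{h > j} lconv μ₁ μ₂ h`; hence `DECAt` at that layer
(`lconv_decAt_of_hdecAtT_dominant`), the mirror statement (`…_left`), and: **two top-affordable laws that are HEAVY-DEC at every layer
below their tops have a convolution that is DEC at EVERY dominant layer** (`lconv_decAt_dominant_of_hdec`).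
PROOF (piece-wise over `μ₂`'s heavy datum, nothing pooled).  Write `Ψ(s) = μ₁{i : i + s ≥ j+1}`; the tail of `μ₁ ∗ {lo, hi; g}` above `j`
is `g·Ψ(hi) + (1−g)·Ψ(lo)`.  (S) a self-sufficient point `b ≤ j` (`2b ≥ T₂`) reads `μ₁`'s row at the layer `j − b`, dominant for `μ₁`
because `2(j − b) ≤ 2j − T₂ < T₁`; (G) a giant pair gives `≥ g ≥ y`; (N) a heavy credit pair `{lo < hi ≤ j; g ≥ y}` with
`T₂ ≤ 2lo + (hi−lo)g ≤ lo + hi` gives `(1−g)·τ + g·(1−u)` with `τ = μ₁{> j−lo}`, `u = μ₁{≤ j−hi}`, and the TWO-LAYER GIANT BOUND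
**`deepLows_le_giants`**: for layers `i′ ≤ i` with `i + i′ < T₁`, the mass of `μ₁` at or below `i′` rides entirely on the giants above `i`
in ANY flow witness of DEC(i) — a mid `m ≤ i` compatible with a low `l ≤ i′` would need `T₁ < l + m ≤ i′ + i` — so
`y·μ₁{≤ i′} ≤ (1−y)·μ₁{> i}`; with `i = j − lo`, `i′ = j − hi` (`i + i′ = 2j − lo − hi < T₁`) this yields the bound `y`.  The LIGHT credit
pairs of `μ₂` at layer `j` are exactly what this argument cannot pay for (their standalone value is only `g < y`); by an exact LP census
(seat folder `work/explore/claimD.py`, `probeD.py`, `lpD2.py`) the far row of the convolution nevertheless holds at every dominant layer for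
ARBITRARY DEC factors (4 916 boundary-pushed instances / 0; a light pair is needed at the layer in ≈ 4 % of them, there always with margin
`≥ 0.13`) — recorded as evidence, not claimed.
HONEST STATUS: a partial result (dominant layers, one heavy factor); `ConvClosedT`, `SDECConvClosed`, `SingleGateConvClosed`, `TreeDEC`,
`FarTreeRow` remain OPEN; the RATE class log\* and the honest sentence of `run/shared/lean/prim/quant/README.md` are unchanged.

* **`LawDec.lconv_tail_ge_of_hdecAtT`** — the theorem; `LawDec.lconv_decAt_of_hdecAtT_dominant`, `LawDec.lconv_decAt_of_hdecAtT_dominant_left`,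
  **`LawDec.lconv_decAt_dominant_of_hdec`**.

[this work]; heavy world: prim-quant-stmt g22; DEC rules ARCH-TREES-G49 §2.2 / DEC-TAMP-G50 §3.1, §3.3 (this lane).  Nothing here is cited as a
published result.  The gluing rows served [cite: KozmaNitzan2024, Conjecture 3 (p. 15)]; product measure [cite: Grimmett1999, §1.3 p. 10].
-/

noncomputable section

namespace Summit.CriticalPhenomena.PercolationContinuityZ3.Theorems

namespace Quant

open Finset

/-- the two-point law `{lo, hi; g}` (as in `…QuantLawDEC`) -/
local notation3 "TP[" lo ", " hi ", " g ", " h "]" =>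
  (g : ℝ) * (if (h : ℕ) = (hi : ℕ) then (1 : ℝ) else 0) + (1 - (g : ℝ)) * (if (h : ℕ) = (lo : ℕ) then (1 : ℝ) else 0)

namespace LawDec

/-! ### One heavy factor suffices at the dominant layers -/

/-- **CONVOLUTION, DOMINANT LAYERS, ONE HEAVY FACTOR.**  `0 < y < 1`; `μ₁` a probability law on `{0..M₁}` with mean `T₁`, top-affordable
(`y·M₁ ≤ T₁`) and DEC(j′) at every `j′ < M₁` (ANY data); `μ₂` a law with a HEAVY datum `HDECAtT y T₂ j M₂ μ₂` at the layer `j` for some real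
`T₂` with `2j < T₁ + T₂`.  Then `y ≤ Σ_{j < h ≤ M₁+M₂} lconv μ₁ μ₂ h`.  See the file header for the proof. [this work] -/
theorem lconv_tail_ge_of_hdecAtT (y T₁ T₂ : ℝ) (j M₁ M₂ : ℕ) (μ₁ μ₂ : ℕ → ℝ) (hy0 : 0 < y) (hy1 : y < 1)
    (h10 : ∀ h, 0 ≤ μ₁ h) (h1M : ∀ h, M₁ < h → μ₁ h = 0) (h11 : ∑ h ∈ Finset.range (M₁ + 1), μ₁ h = 1)
    (hT₁ : ∑ h ∈ Finset.range (M₁ + 1), (h : ℝ) * μ₁ h = T₁) (hta : y * (M₁ : ℝ) ≤ T₁)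
    (hdec : ∀ j', j' < M₁ → DECAt y j' M₁ μ₁) (h2 : HDECAtT y T₂ j M₂ μ₂) (hdom : 2 * (j : ℝ) < T₁ + T₂) :
    y ≤ ∑ h ∈ Finset.Ico (j + 1) (M₁ + M₂ + 1), lconv M₁ M₂ μ₁ μ₂ h := by
  classical
  obtain ⟨ρ, hρ, lam, g, lo, hi, hl0, hl1, hg, hlohi, hhi, hμ₂, hval⟩ := h2
  -- `Ψ(s)`: the mass of `μ₁` at the atoms `i` with `i + s ≥ j+1`
  set Ψ : ℕ → ℝ := fun s => ∑ i ∈ Finset.range (M₁ + 1), μ₁ i * (if j + 1 ≤ i + s then (1 : ℝ) else 0) with hΨ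
  have hΨ0 : ∀ s, 0 ≤ Ψ s := fun s => Finset.sum_nonneg fun i _ => mul_nonneg (h10 i) (by split_ifs <;> norm_num)
  have hΨ1 : ∀ s, j + 1 ≤ s → Ψ s = 1 := by
    intro s hs
    show ∑ i ∈ Finset.range (M₁ + 1), μ₁ i * (if j + 1 ≤ i + s then (1 : ℝ) else 0) = 1
    have e : ∀ i ∈ Finset.range (M₁ + 1), μ₁ i * (if j + 1 ≤ i + s then (1 : ℝ) else 0) = μ₁ i :=
      fun i _ => by rw [if_pos (by omega), mul_one]
    rw [Finset.sum_congr rfl e, h11]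
  have hΨtail : ∀ s, s ≤ j → Ψ s = ∑ i ∈ Finset.range (M₁ + 1), (if (j - s) + 1 ≤ i then μ₁ i else 0) := by
    intro s hs
    refine Finset.sum_congr rfl fun i _ => ?_
    by_cases h1 : j + 1 ≤ i + s
    · rw [if_pos h1, if_pos (by omega), mul_one]
    · rw [if_neg h1, if_neg (by omega), mul_zero]
  -- the tail of the convolution is the `λ`-average of the component tails `g·Ψ(hi) + (1−g)·Ψ(lo)`
  have hrow : ∀ i ∈ Finset.range (M₁ + 1),
      ∑ k ∈ Finset.range (M₂ + 1), (if j + 1 ≤ i + k then μ₁ i * μ₂ k else 0)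
        = ∑ r, lam r * (μ₁ i * (g r * (if j + 1 ≤ i + hi r then (1 : ℝ) else 0)
            + (1 - g r) * (if j + 1 ≤ i + lo r then (1 : ℝ) else 0))) := by
    intro i _
    calc ∑ k ∈ Finset.range (M₂ + 1), (if j + 1 ≤ i + k then μ₁ i * μ₂ k else 0)
        = ∑ k ∈ Finset.range (M₂ + 1), ∑ r, (if j + 1 ≤ i + k then (μ₁ i * lam r) * TP[lo r, hi r, g r, k] else 0) := by
          refine Finset.sum_congr rfl fun k _ => ?_
          by_cases hjk : j + 1 ≤ i + k
          · simp only [if_pos hjk]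
            rw [hμ₂ k, Finset.mul_sum]
            exact Finset.sum_congr rfl fun r _ => by ring
          · simp only [if_neg hjk, Finset.sum_const_zero]
      _ = ∑ r, ∑ k ∈ Finset.range (M₂ + 1), (if j + 1 ≤ i + k then (μ₁ i * lam r) * TP[lo r, hi r, g r, k] else 0) :=
          Finset.sum_comm
      _ = ∑ r, (μ₁ i * lam r) * ∑ k ∈ Finset.range (M₂ + 1), (if j + 1 ≤ i + k then TP[lo r, hi r, g r, k] else 0) := by
          refine Finset.sum_congr rfl fun r _ => ?_
          rw [Finset.mul_sum]
          refine Finset.sum_congr rfl fun k _ => ?_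
          split_ifs <;> ring
      _ = _ := by
          refine Finset.sum_congr rfl fun r _ => ?_
          rw [sum_ite_TP M₂ j i (lo r) (hi r) (g r) ((hlohi r).trans (hhi r)) (hhi r)]
          ring
  have htail : ∑ h ∈ Finset.Ico (j + 1) (M₁ + M₂ + 1), lconv M₁ M₂ μ₁ μ₂ h
      = ∑ r, lam r * (g r * Ψ (hi r) + (1 - g r) * Ψ (lo r)) := by
    rw [conv_tail_eq, Finset.sum_congr rfl hrow, Finset.sum_comm]
    refine Finset.sum_congr rfl fun r _ => ?_
    rw [← Finset.mul_sum]
    congr 1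
    show ∑ i ∈ Finset.range (M₁ + 1), μ₁ i * (g r * (if j + 1 ≤ i + hi r then (1 : ℝ) else 0)
        + (1 - g r) * (if j + 1 ≤ i + lo r then (1 : ℝ) else 0))
      = g r * ∑ i ∈ Finset.range (M₁ + 1), μ₁ i * (if j + 1 ≤ i + hi r then (1 : ℝ) else 0)
        + (1 - g r) * ∑ i ∈ Finset.range (M₁ + 1), μ₁ i * (if j + 1 ≤ i + lo r then (1 : ℝ) else 0)
    rw [Finset.mul_sum, Finset.mul_sum, ← Finset.sum_add_distrib]
    exact Finset.sum_congr rfl fun i _ => by ring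
  -- every charged heavy component has tail at least `y`
  have hcomp : ∀ r, 0 < lam r → y ≤ g r * Ψ (hi r) + (1 - g r) * Ψ (lo r) := by
    intro r hr
    rcases hval r hr with ⟨heq, hS⟩ | ⟨_, hgi, hyg⟩ | ⟨hlt, hhij, hyg, hcr⟩
    · -- (S) a point `b = lo = hi`
      rw [← heq]
      have e : g r * Ψ (lo r) + (1 - g r) * Ψ (lo r) = Ψ (lo r) := by ring
      rw [e]
      rcases hS with h2b | hbj
      · by_cases hbj' : j + 1 ≤ lo r
        · rw [hΨ1 _ hbj']; exact hy1.le
        · have hbj : lo r ≤ j := by omega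
          rw [hΨtail _ hbj]
          refine tail_ge_of_decAt_all y T₁ M₁ (j - lo r) μ₁ hy0 hy1 h10 h1M h11 hT₁ hta hdec ?_
          rw [Nat.cast_sub hbj]
          linarith
      · rw [hΨ1 _ hbj]; exact hy1.le
    · -- (G) a giant pair: `Ψ(hi) = 1`
      rw [hΨ1 _ hgi, mul_one]
      nlinarith [hΨ0 (lo r), (hg r).2]
    · -- (N) a heavy credit pair `lo < hi ≤ j`
      have hloj : lo r ≤ j := hlt.le.trans hhij
      set τ : ℝ := ∑ i ∈ Finset.range (M₁ + 1), (if (j - lo r) + 1 ≤ i then μ₁ i else 0) with hτ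
      set u : ℝ := ∑ i ∈ Finset.range (M₁ + 1), (if i ≤ j - hi r then μ₁ i else 0) with hu
      have eΨlo : Ψ (lo r) = τ := hΨtail _ hloj
      have eΨhi : Ψ (hi r) = 1 - u := by
        rw [hΨtail _ hhij]
        have hs := sum_le_add_sum_gt M₁ (j - hi r) μ₁
        rw [h11] at hs
        linarith
      -- the two-layer giant bound at `i = j − lo`, `i′ = j − hi`
      have hii : j - hi r ≤ j - lo r := by omega
      have hdeep : ((j - lo r : ℕ) : ℝ) + ((j - hi r : ℕ) : ℝ) < T₁ := by
        rw [Nat.cast_sub hloj, Nat.cast_sub hhij]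
        have hd : (0 : ℝ) ≤ (hi r : ℝ) - lo r := by
          have : (lo r : ℝ) ≤ hi r := by exact_mod_cast hlt.le
          linarith
        have hcr' : T₂ ≤ (lo r : ℝ) + hi r := by nlinarith [(hg r).2]
        linarith
      have hgb := deepLows_le_giants y T₁ M₁ (j - lo r) (j - hi r) μ₁ hy0 hy1 h10 h1M h11 hT₁ hta hdec hii hdeep
      have hτu : τ ≤ 1 - u := by
        have hmono := sum_gt_antitone M₁ (j - lo r) (j - hi r) μ₁ h10 hii
        have hs := sum_le_add_sum_gt M₁ (j - hi r) μ₁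
        rw [h11] at hs
        rw [hτ, hu]; linarith
      have hu0 : 0 ≤ u := Finset.sum_nonneg fun i _ => by split_ifs; exacts [h10 i, le_rfl]
      rw [eΨlo, eΨhi]
      -- `g(1−u) + (1−g)τ − y = g(1 − u − τ) + τ − y ≥ y(1 − u − τ) + τ − y = (1−y)τ − y·u ≥ 0`
      have h1 : y * (1 - u - τ) ≤ g r * (1 - u - τ) := mul_le_mul_of_nonneg_right hyg (by linarith)
      rw [← hτ, ← hu] at hgb
      linarith
  -- sum over the datum
  rw [htail]
  calc y = ∑ r, lam r * y := by rw [← Finset.sum_mul, hl1, one_mul]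
    _ ≤ ∑ r, lam r * (g r * Ψ (hi r) + (1 - g r) * Ψ (lo r)) := by
        refine Finset.sum_le_sum fun r _ => ?_
        rcases (hl0 r).eq_or_lt with hz | hpos
        · rw [← hz, zero_mul, zero_mul]
        · exact mul_le_mul_of_nonneg_left (hcomp r hpos) (hl0 r)

/-- **DEC AT A DOMINANT LAYER OF THE CONVOLUTION, ONE HEAVY FACTOR**: as `lconv_tail_ge_of_hdecAtT` with `μ₂` a probability law on `{0..M₂}`
— then `lconv μ₁ μ₂` is `DECAt y j (M₁ + M₂)` (the far split `decAt_of_tail_ge`). [this work] -/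
theorem lconv_decAt_of_hdecAtT_dominant (y T₁ T₂ : ℝ) (j M₁ M₂ : ℕ) (μ₁ μ₂ : ℕ → ℝ) (hy0 : 0 < y) (hy1 : y < 1)
    (h10 : ∀ h, 0 ≤ μ₁ h) (h1M : ∀ h, M₁ < h → μ₁ h = 0) (h11 : ∑ h ∈ Finset.range (M₁ + 1), μ₁ h = 1)
    (hT₁ : ∑ h ∈ Finset.range (M₁ + 1), (h : ℝ) * μ₁ h = T₁) (hta : y * (M₁ : ℝ) ≤ T₁)
    (hdec : ∀ j', j' < M₁ → DECAt y j' M₁ μ₁)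
    (h20 : ∀ h, 0 ≤ μ₂ h) (h21 : ∑ h ∈ Finset.range (M₂ + 1), μ₂ h = 1)
    (h2 : HDECAtT y T₂ j M₂ μ₂) (hdom : 2 * (j : ℝ) < T₁ + T₂) :
    DECAt y j (M₁ + M₂) (lconv M₁ M₂ μ₁ μ₂) :=
  decAt_of_tail_ge (M₁ + M₂) (lconv M₁ M₂ μ₁ μ₂) (lconv_nonneg M₁ M₂ μ₁ μ₂ h10 h20)
    (fun h hh => lconv_eq_zero M₁ M₂ μ₁ μ₂ h hh) (sum_lconv M₁ M₂ μ₁ μ₂ h11 h21) y j hy0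
    (lconv_tail_ge_of_hdecAtT y T₁ T₂ j M₁ M₂ μ₁ μ₂ hy0 hy1 h10 h1M h11 hT₁ hta hdec h2 hdom)

/-- **THE MIRROR STATEMENT**: `μ₁` with a heavy datum at layer `j`, `μ₂` a top-affordable probability law DEC at every layer below its top,
`2j < T₁ + T₂` ⟹ `lconv μ₁ μ₂` is `DECAt y j (M₁ + M₂)` (`lconv_comm`). [this work] -/
theorem lconv_decAt_of_hdecAtT_dominant_left (y T₁ T₂ : ℝ) (j M₁ M₂ : ℕ) (μ₁ μ₂ : ℕ → ℝ) (hy0 : 0 < y) (hy1 : y < 1)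
    (h10 : ∀ h, 0 ≤ μ₁ h) (h11 : ∑ h ∈ Finset.range (M₁ + 1), μ₁ h = 1) (h1 : HDECAtT y T₁ j M₁ μ₁)
    (h20 : ∀ h, 0 ≤ μ₂ h) (h2M : ∀ h, M₂ < h → μ₂ h = 0) (h21 : ∑ h ∈ Finset.range (M₂ + 1), μ₂ h = 1)
    (hT₂ : ∑ h ∈ Finset.range (M₂ + 1), (h : ℝ) * μ₂ h = T₂) (hta : y * (M₂ : ℝ) ≤ T₂)
    (hdec : ∀ j', j' < M₂ → DECAt y j' M₂ μ₂) (hdom : 2 * (j : ℝ) < T₁ + T₂) :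
    DECAt y j (M₁ + M₂) (lconv M₁ M₂ μ₁ μ₂) := by
  rw [lconv_comm, Nat.add_comm]
  exact lconv_decAt_of_hdecAtT_dominant y T₂ T₁ j M₂ M₁ μ₂ μ₁ hy0 hy1 h20 h2M h21 hT₂ hta hdec h10 h11 h1 (by linarith)

/-- **TWO HEAVY-DEC LAWS HAVE A CONVOLUTION THAT IS DEC AT EVERY DOMINANT LAYER.**  `μ₁`, `μ₂` top-affordable probability laws on
`{0..M₁}`, `{0..M₂}` (means `T₁`, `T₂`) that are HEAVY-DEC at every layer below their tops (`HDECAtT y Tᵢ j′ Mᵢ μᵢ` for all `j′ < Mᵢ`);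
then `lconv μ₁ μ₂` is `DECAt y j (M₁+M₂)` at every layer `j` with `2j < T₁ + T₂`.  (If `j < M₂` use `μ₂`'s datum at `j`; otherwise
`j < M₁`, since `M₁ + M₂ ≤ 2j < T₁ + T₂ ≤ M₁ + M₂` is absurd, and the mirror statement applies.) [this work] -/
theorem lconv_decAt_dominant_of_hdec (y T₁ T₂ : ℝ) (j M₁ M₂ : ℕ) (μ₁ μ₂ : ℕ → ℝ) (hy0 : 0 < y) (hy1 : y < 1)
    (h10 : ∀ h, 0 ≤ μ₁ h) (h1M : ∀ h, M₁ < h → μ₁ h = 0) (h11 : ∑ h ∈ Finset.range (M₁ + 1), μ₁ h = 1)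
    (hT₁ : ∑ h ∈ Finset.range (M₁ + 1), (h : ℝ) * μ₁ h = T₁) (hta1 : y * (M₁ : ℝ) ≤ T₁)
    (hH1 : ∀ j', j' < M₁ → HDECAtT y T₁ j' M₁ μ₁)
    (h20 : ∀ h, 0 ≤ μ₂ h) (h2M : ∀ h, M₂ < h → μ₂ h = 0) (h21 : ∑ h ∈ Finset.range (M₂ + 1), μ₂ h = 1)
    (hT₂ : ∑ h ∈ Finset.range (M₂ + 1), (h : ℝ) * μ₂ h = T₂) (hta2 : y * (M₂ : ℝ) ≤ T₂)
    (hH2 : ∀ j', j' < M₂ → HDECAtT y T₂ j' M₂ μ₂) (hdom : 2 * (j : ℝ) < T₁ + T₂) :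
    DECAt y j (M₁ + M₂) (lconv M₁ M₂ μ₁ μ₂) := by
  have hdec1 : ∀ j', j' < M₁ → DECAt y j' M₁ μ₁ := fun j' hj' => by
    rw [decAt_iff_decAtT, hT₁]; exact (hH1 j' hj').decAtT
  have hdec2 : ∀ j', j' < M₂ → DECAt y j' M₂ μ₂ := fun j' hj' => by
    rw [decAt_iff_decAtT, hT₂]; exact (hH2 j' hj').decAtT
  by_cases hj2 : j < M₂
  · exact lconv_decAt_of_hdecAtT_dominant y T₁ T₂ j M₁ M₂ μ₁ μ₂ hy0 hy1 h10 h1M h11 hT₁ hta1 hdec1 h20 h21 (hH2 j hj2) hdom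
  · have hj1 : j < M₁ := by
      by_contra hc
      have hm1 := lawMean_le_top M₁ μ₁ h10 h11
      have hm2 := lawMean_le_top M₂ μ₂ h20 h21
      rw [hT₁] at hm1; rw [hT₂] at hm2
      have e1 : (M₂ : ℝ) ≤ j := by exact_mod_cast not_lt.1 hj2
      have e2 : (M₁ : ℝ) ≤ j := by exact_mod_cast not_lt.1 hc
      linarith
    exact lconv_decAt_of_hdecAtT_dominant_left y T₁ T₂ j M₁ M₂ μ₁ μ₂ hy0 hy1 h10 h11 (hH1 j hj1) h20 h2M h21 hT₂ hta2 hdec2 hdom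

end LawDec

end Quant

end Summit.CriticalPhenomena.PercolationContinuityZ3.Theorems
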